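import Literature.AlgebraicGeometry.Resolution.AlterationsNormalFormBlowup
import Literature.AlgebraicGeometry.Resolution.FormalNormalCrossingsEtale
import Literature.AlgebraicGeometry.Resolution.FormalBranchesLocal
import Literature.AlgebraicGeometry.Resolution.EtaleSpread
import Literature.AlgebraicGeometry.Resolution.RegularImpliesSmooth
import Literature.AlgebraicGeometry.Resolution.ArtinApproximationProofs
import Literature.AlgebraicGeometry.Resolution.AlterationsBoundarySmoothLocus
import Mathlib.AlgebraicGeometry.AlgClosed.Basic
import HarnessLib

/-!
# `DeJong1996FormalNormalCrossings` holds: formal normal crossings are normal crossings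
(de Jong 1996, 4.25 (i) ⇒ 2.4), without Artin approximation

Topic: `Literature/AlgebraicGeometry/Resolution`. DISCHARGE of the named fact
`DeJong1996FormalNormalCrossings` of `AlterationsNormalFormBlowup.lean` — the equivalence used
silently by de Jong 1996 between the complete-local-ring description of a normal crossings
divisor in 4.25 (i)/4.27 (Kollár 2007, Rem. 1.45: "local analytic or formal coordinates … such
that `D = (∏ᵢ xᵢ^{mᵢ} = 0)`") and the étale-local Definition 2.4 invoked in 4.28 (Stacks 0BSF):
for a pair `(X, Z)` in Situation 4.25 (`DeJong1996.NormalFormPair f Z d`) with `X` regular, `Z` is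
a normal crossings divisor (`IsNormalCrossingsDivisor`).

The tree already reduces the fact to Artin's approximation theorem
(`DeJong1996FormalNormalCrossings.of_artinApproximation`, `FormalNormalCrossingsEtale.lean`), itself
reduced to Popescu's theorem and Mizutani's theorem, both open. This file proves it
UNCONDITIONALLY, along the elementary route prepared in `FormalBranchesModel.lean`,
`FormalBranchesChart.lean`, `FormalBranchesJacobian.lean`, `FormalBranchesSplitting.lean`,
`FormalBranchesLocal.lean` and `EtaleSpread.lean`: the formal branches of `Z` at a closed point
`x` are algebraised by the generic chart of the blow-up of `Z` along the Jacobian ideal of its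
double locus (a FINITE algebra `C` over `𝒪_{X,x}` with `𝒪̂ ⊗ C ≅ Π_j 𝒪̂/(x_j)`, because affine
blow-up algebras commute with the flat base change `𝒪 → 𝒪̂`), the finite algebra `C` splits
étale-locally (Stacks 00UL, Mathlib), the branch ideals then descend from the completion to the
étale neighbourhood by faithful flatness, and strict normal crossings descend with them
(`exists_rsop_prod_of_flat`). No excellence or G-ring property of `𝒪_{X,x}` is used.

* `essFiniteType_formallySmooth_stalk` — the local ring of a regular point of a scheme locally of
  finite type over a perfect field is essentially of finite type and formally smooth over the
  field (tree `isSmoothAt_of_isRegularLocalRing_of_formallySmooth_residueField`, Stacks 00TV);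
* `exists_etale_isStrictNormalCrossingsAt_of_formal_of_isAlgClosed` — the pointwise theorem of
  `FormalNormalCrossingsEtale.lean` without the Artin hypothesis: local algebra
  (`exists_etale_isSNCIdeal_of_formal`), spreading of the étale algebra to an affine chart
  (`exists_etale_spread`), and the étale neighbourhood `Spec E → Spec Γ(X, W) → X`, whose local
  ring `E_Q ≅ R'_P` carries the extended ideal of `Z` (Mathlib `Spec.stalkIso`,
  `Spec.algebraMap_stalkIso_inv`; tree `appLE_SpecMap_comp_fromSpec`, `stalkIdeal_comap`);
* `DeJong1996FormalNormalCrossings_holds` — the fact, assembled exactly as in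
  `DeJong1996FormalNormalCrossings.of_artinApproximation` (spreading to a neighbourhood,
  `StrictNormalCrossingsSpread.lean`; closed points suffice, `NormalCrossingsLocal.lean`).

## Sources

* A. J. de Jong, *Smoothness, semi-stability and alterations*, Publ. Math. IHÉS 83 (1996),
  2.4 (p. 55), 4.25–4.28 (pp. 75–76). [DeJong1996]
* J. Kollár, *Lectures on Resolution of Singularities*, Ann. of Math. Stud. 166 (2007),
  Rem. 1.45. [Kollar2007]
* The Stacks Project, Tags 0BSF, 0CBS, 0C2E (the statement), 00UL, 00TV (the proof).
  [StacksProject]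
-/

noncomputable section

open CategoryTheory CategoryTheory.Limits AlgebraicGeometry TopologicalSpace Topology IsLocalRing
  Scheme.IdealSheafData

namespace Literature.AlgebraicGeometry.Resolution

universe u

/-! ## Small lemmas -/

/-- An ideal with local strict normal crossings data is radical. [folklore] -/
theorem IsSNCIdeal.radical_eq {A : Type u} [CommRing A] [IsLocalRing A] {I : Ideal A}
    (h : IsSNCIdeal I) : I.radical = I := by
  obtain ⟨r, x, hx, -, hli, rfl⟩ := h.exists_linearIndependent
  haveI := h.isRegularLocalRing
  exact radical_span_singleton_prod_of_linearIndependent_toCotangent x hx hli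

/-! ## The local ring of a point of a scheme locally of finite type over a field -/

section Stalk

variable {k : Type u} [Field k] {X : Scheme.{u}} (f : X ⟶ Spec (.of k)) [LocallyOfFiniteType f]
  {W : X.Opens} (hW : IsAffineOpen W)

/-- The `k`-algebra structure on the sections over an affine open. [folklore] -/
@[reducible] def sectionsAlgebraOfOver : Algebra k Γ(X, W) :=
  ((f.appLE ⊤ W le_top).hom.comp (Scheme.ΓSpecIso (.of k)).inv.hom).toAlgebra

include hW in
/-- The sections over an affine open are of finite type over `k`. [folklore] -/
theorem finiteType_sectionsOfOver :
    letI := sectionsAlgebraOfOver f (W := W)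
    Algebra.FiniteType k Γ(X, W) := by
  letI := sectionsAlgebraOfOver f (W := W)
  have hft : RingHom.FiniteType (f.appLE ⊤ W le_top).hom :=
    HasRingHomProperty.appLE @LocallyOfFiniteType f inferInstance ⟨⊤, isAffineOpen_top _⟩
      ⟨W, hW⟩ le_top
  exact hft.comp (RingHom.FiniteType.of_surjective _
    (Scheme.ΓSpecIso (.of k)).commRingCatIsoToRingEquiv.symm.surjective)


include hW in
/-- **The local ring of a regular point of a scheme locally of finite type over a perfect field
is essentially of finite type and formally smooth over the field** (regular + separable residue
field ⇒ smooth, Stacks 00TV, tree `isSmoothAt_of_isRegularLocalRing_of_formallySmooth_residueField`),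
for the `k`-algebra structure `k → Γ(X, W) → 𝒪_{X,x}` of an affine open `W ∋ x`.
[cite: StacksProject, Tag 00TV] -/
theorem essFiniteType_formallySmooth_stalk [PerfectField k] {x : X} (hxW : x ∈ W)
    (hreg : IsRegularLocalRing (X.presheaf.stalk x)) :
    letI := sectionsAlgebraOfOver f (W := W)
    letI : Algebra Γ(X, W) (X.presheaf.stalk x) :=
      TopCat.Presheaf.algebra_section_stalk X.presheaf (⟨x, hxW⟩ : W)
    letI : Algebra k (X.presheaf.stalk x) :=
      ((algebraMap Γ(X, W) (X.presheaf.stalk x)).comp (algebraMap k Γ(X, W))).toAlgebra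
    Algebra.EssFiniteType k (X.presheaf.stalk x) ∧ Algebra.FormallySmooth k (X.presheaf.stalk x) := by
  letI := sectionsAlgebraOfOver f (W := W)
  letI algA : Algebra Γ(X, W) (X.presheaf.stalk x) :=
    TopCat.Presheaf.algebra_section_stalk X.presheaf (⟨x, hxW⟩ : W)
  letI : Algebra k (X.presheaf.stalk x) :=
    ((algebraMap Γ(X, W) (X.presheaf.stalk x)).comp (algebraMap k Γ(X, W))).toAlgebra
  haveI : IsScalarTower k Γ(X, W) (X.presheaf.stalk x) := IsScalarTower.of_algebraMap_eq fun _ => rfl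
  haveI hlocA := hW.isLocalization_stalk ⟨x, hxW⟩
  set 𝔭 := (hW.primeIdealOf ⟨x, hxW⟩).asIdeal with h𝔭
  haveI : Algebra.FiniteType k Γ(X, W) := finiteType_sectionsOfOver f hW
  haveI : Algebra.EssFiniteType Γ(X, W) (X.presheaf.stalk x) :=
    Algebra.EssFiniteType.of_isLocalization _ 𝔭.primeCompl
  have hEss : Algebra.EssFiniteType k (X.presheaf.stalk x) :=
    Algebra.EssFiniteType.comp k Γ(X, W) _
  refine ⟨hEss, ?_⟩
  -- smoothness at the prime `𝔭`
  haveI : Algebra.FinitePresentation k Γ(X, W) :=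
    (Algebra.FinitePresentation.of_finiteType (R := k) (A := Γ(X, W))).mp inferInstance
  haveI : IsRegularLocalRing (Localization.AtPrime 𝔭) :=
    IsRegularLocalRing.of_ringEquiv
      (IsLocalization.algEquiv 𝔭.primeCompl (X.presheaf.stalk x) (Localization.AtPrime 𝔭)).toRingEquiv
  haveI : Algebra.EssFiniteType k (Localization.AtPrime 𝔭) :=
    Algebra.EssFiniteType.comp k Γ(X, W) _
  haveI : Algebra.FormallySmooth k (ResidueField (Localization.AtPrime 𝔭)) :=
    formallySmooth_residueField_of_perfectField (k := k) (A := Localization.AtPrime 𝔭)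
  have hsm : Algebra.IsSmoothAt k 𝔭 :=
    isSmoothAt_of_isRegularLocalRing_of_formallySmooth_residueField k Γ(X, W) 𝔭
  exact Algebra.FormallySmooth.of_equiv
    ((IsLocalization.algEquiv 𝔭.primeCompl (Localization.AtPrime 𝔭) (X.presheaf.stalk x)).restrictScalars k)

end Stalk

/-! ## The pointwise theorem without Artin approximation -/

/-- **Formal normal crossings give strict normal crossings at a point of an étale
neighbourhood** — the statement of `exists_etale_isStrictNormalCrossingsAt_of_formal`
(`FormalNormalCrossingsEtale.lean`) WITHOUT the hypothesis `Artin1969EtaleApproximation`, over an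
algebraically closed (indeed any perfect) field: at a point `x` of `X` (locally of finite type
over `k`) with `𝒪_{X,x}` regular of dimension `d` and `(𝒪̂_{X,x}, Î_Z) ≅ (k⟦X₁, …, X_d⟧, (X₁ ⋯ X_r))`
there is an étale `g : U → X` and `u ↦ x` such that `g⁻¹ Z` satisfies the strict normal crossings
condition at `u`. Proof: the local algebra `exists_etale_isSNCIdeal_of_formal`
(`FormalBranchesLocal.lean`: Jacobian ideal of the double locus, its blow-up chart, étale
splitting and descent) on `A = 𝒪_{X,x}`, which is essentially of finite type and formally smooth
over `k` (`essFiniteType_formallySmooth_stalk`), gives an étale `A`-algebra; it spreads to an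
étale algebra `E` over an affine chart `Γ(X, W)` (`exists_etale_spread`, `EtaleSpread.lean`), and
`U = Spec E → Spec Γ(X, W) → X` with the point `Q` is the étale neighbourhood, the local ring
`𝒪_{U,u} = E_Q ≅ R'_P` carrying the extended ideal of `Z`. [cite: DeJong1996, 2.4 and 4.25 (i), pp. 55, 75] -/
theorem exists_etale_isStrictNormalCrossingsAt_of_formal_of_isAlgClosed
    {k : Type u} [Field k] [IsAlgClosed k] {X : Scheme.{u}} (f : X ⟶ Spec (.of k))
    [LocallyOfFiniteType f] {Z : Set X} (hZ : IsClosed Z) {x : X}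
    (hreg : IsRegularLocalRing (X.presheaf.stalk x))
    {d r : ℕ} (hr : 1 ≤ r) (hrd : r ≤ d) (hdim : ringKrullDim (X.presheaf.stalk x) = d)
    (e : AdicCompletion (maximalIdeal (X.presheaf.stalk x)) (X.presheaf.stalk x) ≃+*
      MvPowerSeries (Fin d) k)
    (he : ∀ (U : X.affineOpens) (hU : x ∈ (U : X.Opens)),
      (completedStalkIdeal (vanishingIdeal ⟨Z, hZ⟩) x U hU).map e.toRingHom =
        Ideal.span {DeJong1996.normalCrossingsEquation k d r}) :
    ∃ (U : Scheme.{u}) (g : U ⟶ X), Etale g ∧ ∃ u : U, g u = x ∧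
      IsStrictNormalCrossingsAt U (g ⁻¹' Z) u := by
  classical
  haveI : IsLocallyNoetherian X := LocallyOfFiniteType.isLocallyNoetherian f
  haveI : PerfectField k := IsAlgClosed.perfectField k
  /- (1) an affine chart `W ∋ x` and the `k`-algebra `A = 𝒪_{X,x}` -/
  obtain ⟨W, hW, hxW, -⟩ :=
    exists_isAffineOpen_mem_and_subset (X := X) (x := x) (U := ⊤) trivial
  letI := sectionsAlgebraOfOver f (W := W)
  letI algA : Algebra Γ(X, W) (X.presheaf.stalk x) :=
    TopCat.Presheaf.algebra_section_stalk X.presheaf (⟨x, hxW⟩ : W)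
  letI : Algebra k (X.presheaf.stalk x) :=
    ((algebraMap Γ(X, W) (X.presheaf.stalk x)).comp (algebraMap k Γ(X, W))).toAlgebra
  haveI : IsScalarTower k Γ(X, W) (X.presheaf.stalk x) := IsScalarTower.of_algebraMap_eq fun _ => rfl
  haveI hlocA := hW.isLocalization_stalk ⟨x, hxW⟩
  obtain ⟨hEss, hSm⟩ := essFiniteType_formallySmooth_stalk f hW hxW hreg
  haveI := hEss
  haveI := hSm
  haveI := hreg
  /- (2) the ideal of `Z` at `x` and its formal description -/
  let I : Ideal (X.presheaf.stalk x) := stalkIdeal (vanishingIdeal ⟨Z, hZ⟩) x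
  have hIW : I = ((vanishingIdeal ⟨Z, hZ⟩).ideal ⟨W, hW⟩).map (X.presheaf.germ W x hxW).hom :=
    stalkIdeal_eq_map_germ _ ⟨W, hW⟩ hxW
  have he' : (I.map (algebraMap _ (AdicCompletion (maximalIdeal (X.presheaf.stalk x))
      (X.presheaf.stalk x)))).map e.toRingHom =
      Ideal.span {∏ i ∈ Finset.univ.filter (fun i : Fin d => (i : ℕ) < r), MvPowerSeries.X i} := by
    rw [hIW]
    exact he ⟨W, hW⟩ hxW
  /- (3) the local algebra: an étale `A`-algebra with strict normal crossings at a prime -/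
  obtain ⟨R', _, _, _, P, _, _, -, hsnc⟩ :=
    exists_etale_isSNCIdeal_of_formal (k := k) hdim hr hrd I e he'
  /- (4) spread it to an étale algebra over `Γ(X, W)` -/
  letI : Algebra Γ(X, W) R' :=
    ((algebraMap (X.presheaf.stalk x) R').comp (algebraMap Γ(X, W) (X.presheaf.stalk x))).toAlgebra
  haveI : IsScalarTower Γ(X, W) (X.presheaf.stalk x) R' := IsScalarTower.of_algebraMap_eq fun _ => rfl
  obtain ⟨E, _, _, _, Q, _, hQ, ⟨ι⟩⟩ :=
    exists_etale_spread (hW.primeIdealOf ⟨x, hxW⟩).asIdeal.primeCompl (A := X.presheaf.stalk x) P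
  -- `Q` lies over the prime of `x`
  have hQx : Q.under Γ(X, W) = (hW.primeIdealOf ⟨x, hxW⟩).asIdeal := by
    rw [hQ, ← Ideal.under_under (B := X.presheaf.stalk x), ← P.over_def (maximalIdeal _)]
    exact IsLocalization.AtPrime.under_maximalIdeal (X.presheaf.stalk x) _
  /- (5) the étale neighbourhood `g : Spec E → Spec Γ(X, W) → X` and its point -/
  let φ : Γ(X, W) ⟶ CommRingCat.of E := CommRingCat.ofHom (algebraMap Γ(X, W) E)
  let g : Spec (.of E) ⟶ X := Spec.map φ ≫ hW.fromSpec
  let u : PrimeSpectrum (CommRingCat.of E) := ⟨Q, inferInstance⟩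
  have hgu₀ : Spec.map φ u = hW.primeIdealOf ⟨x, hxW⟩ := PrimeSpectrum.ext hQx
  have hgu : g u = x := by
    change hW.fromSpec (Spec.map φ u) = x
    rw [hgu₀]
    exact hW.fromSpec_primeIdealOf ⟨x, hxW⟩
  -- make `x = g u` definitional
  subst hgu
  haveI : Etale (Spec.map φ) :=
    (HasRingHomProperty.Spec_iff (P := @Etale)).mpr (RingHom.etale_algebraMap.mpr ‹Algebra.Etale Γ(X, W) E›)
  haveI : Etale g := inferInstance
  refine ⟨Spec (.of E), g, inferInstance, u, rfl, ?_⟩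
  /- (6) the stalk map at `u` is `A → R'_P ≅ E_Q = 𝒪_{Spec E, u}` -/
  have hle : (⊤ : (Spec (CommRingCat.of E)).Opens) ≤ g ⁻¹ᵁ W := fun y _ => by
    change hW.fromSpec (Spec.map φ y) ∈ (W : Set X)
    rw [← hW.range_fromSpec]
    exact ⟨_, rfl⟩
  haveI : IsScalarTower Γ(X, W) (X.presheaf.stalk (g u)) (Localization.AtPrime P) :=
    IsScalarTower.of_algebraMap_eq fun a => by
      rw [IsScalarTower.algebraMap_apply (X.presheaf.stalk (g u)) R' (Localization.AtPrime P),
        IsScalarTower.algebraMap_apply Γ(X, W) R' (Localization.AtPrime P),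
        IsScalarTower.algebraMap_apply Γ(X, W) (X.presheaf.stalk (g u)) R']
  let Θ : Localization.AtPrime P ≃+* (Spec (CommRingCat.of E)).presheaf.stalk u :=
    ι.symm.toRingEquiv.trans (Spec.stalkIso (.of E) u).commRingCatIsoToRingEquiv.symm
  have hΘ : (g.stalkMap u).hom =
      (Θ : Localization.AtPrime P →+* (Spec (CommRingCat.of E)).presheaf.stalk u).comp
        (algebraMap (X.presheaf.stalk (g u)) (Localization.AtPrime P)) := by
    refine IsLocalization.ringHom_ext (hW.primeIdealOf ⟨g u, hxW⟩).asIdeal.primeCompl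
      (RingHom.ext fun a => ?_)
    change (g.stalkMap u).hom ((X.presheaf.germ W (g u) hxW).hom a) =
      Θ (algebraMap (X.presheaf.stalk (g u)) (Localization.AtPrime P)
        ((X.presheaf.germ W (g u) hxW).hom a))
    -- left: through `appLE`
    have h1 : (g.stalkMap u).hom ((X.presheaf.germ W (g u) hxW).hom a) =
        ((Spec (CommRingCat.of E)).presheaf.germ ⊤ u trivial).hom
          ((Scheme.ΓSpecIso (.of E)).inv.hom (algebraMap Γ(X, W) E a)) := by
      rw [← germ_appLE_eq_stalkMap_germ g W ⊤ u trivial hle a]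
      change _ = ((Spec (CommRingCat.of E)).presheaf.germ ⊤ u trivial).hom
        ((φ ≫ (Scheme.ΓSpecIso (.of E)).inv).hom a)
      rw [← appLE_SpecMap_comp_fromSpec hW φ hle]
    -- right: through `E_Q`
    have h2 : Θ (algebraMap (X.presheaf.stalk (g u)) (Localization.AtPrime P)
        ((X.presheaf.germ W (g u) hxW).hom a)) =
        ((Spec (CommRingCat.of E)).presheaf.germ ⊤ u trivial).hom
          ((Scheme.ΓSpecIso (.of E)).inv.hom (algebraMap Γ(X, W) E a)) := by
      have h3 : algebraMap (X.presheaf.stalk (g u)) (Localization.AtPrime P)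
          ((X.presheaf.germ W (g u) hxW).hom a) = algebraMap Γ(X, W) (Localization.AtPrime P) a :=
        (IsScalarTower.algebraMap_apply Γ(X, W) (X.presheaf.stalk (g u)) (Localization.AtPrime P) a).symm
      rw [h3]
      change (Spec.stalkIso (.of E) u).inv.hom (ι.symm (algebraMap Γ(X, W) (Localization.AtPrime P) a)) = _
      rw [AlgEquiv.commutes, IsScalarTower.algebraMap_apply Γ(X, W) E (Localization.AtPrime Q)]
      have hinv := congrArg (fun ψ => ψ.hom (algebraMap Γ(X, W) E a))
        (Spec.algebraMap_stalkIso_inv (R := CommRingCat.of E) (x := u))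
      simpa only [CommRingCat.hom_comp, RingHom.comp_apply, CommRingCat.hom_ofHom] using hinv
    rw [h1, h2]
  /- (7) the ideal of `g⁻¹ Z` at `u` is the extension of the ideal of `Z` at `g u` -/
  unfold IsStrictNormalCrossingsAt
  letI algB := TopCat.Presheaf.algebra_section_stalk (Spec (CommRingCat.of E)).presheaf
    (⟨u, trivial⟩ : (⊤ : (Spec (CommRingCat.of E)).Opens))
  haveI hlocB := (isAffineOpen_top (Spec (CommRingCat.of E))).isLocalization_stalk ⟨u, trivial⟩
  have hcl : (⟨closure (g ⁻¹' Z), isClosed_closure⟩ : Closeds (Spec (CommRingCat.of E))) =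
      ⟨g ⁻¹' Z, hZ.preimage g.continuous⟩ :=
    Closeds.ext (hZ.preimage g.continuous).closure_eq
  have hrad : ∀ J : Ideal Γ(Spec (CommRingCat.of E), ⊤),
      (J.radical).map ((Spec (CommRingCat.of E)).presheaf.germ ⊤ u trivial).hom =
        (J.map ((Spec (CommRingCat.of E)).presheaf.germ ⊤ u trivial).hom).radical := fun J =>
    IsLocalization.map_radical
      ((isAffineOpen_top (Spec (CommRingCat.of E))).primeIdealOf ⟨u, trivial⟩).asIdeal.primeCompl
      ((Spec (CommRingCat.of E)).presheaf.stalk u) J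
  rw [hcl, vanishingIdeal_preimage_eq_radical_comap g hZ,
    stalkIdeal_eq_map_germ _ ⟨⊤, isAffineOpen_top _⟩ trivial, radical_ideal, hrad,
    ← stalkIdeal_eq_map_germ _ ⟨⊤, isAffineOpen_top _⟩ trivial,
    Scheme.IdealSheafData.comap_comp, stalkIdeal_comap (Spec.map φ),
    stalkIdeal_comap_of_isOpenImmersion hW.fromSpec, Ideal.map_map, ← CommRingCat.hom_comp,
    ← Scheme.Hom.stalkMap_comp]
  change IsSNCIdeal ((I.map (g.stalkMap u).hom).radical)
  have key : IsSNCIdeal ((I.map (algebraMap _ (Localization.AtPrime P))).map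
      (Θ : Localization.AtPrime P →+* (Spec (CommRingCat.of E)).presheaf.stalk u)) :=
    IsSNCIdeal.of_ringEquiv Θ hsnc
  rw [hΘ, ← Ideal.map_map, key.radical_eq]
  exact key

/-! ## The named fact -/

/-- **`DeJong1996FormalNormalCrossings` holds** (de Jong 1996, the equivalence used silently
between 4.25 (i) and 4.28/2.4: formal normal crossings are normal crossings), proved WITHOUT
Artin approximation: for a pair `(X, Z)` in Situation 4.25 (`DeJong1996.NormalFormPair f Z d`)
with `X` regular, at every closed point `p ∈ Z` the formal condition 4.25 (i) gives an étale
neighbourhood on which the preimage of `Z` has strict normal crossings at a point over `p`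
(`exists_etale_isStrictNormalCrossingsAt_of_formal_of_isAlgClosed`), hence on a neighbourhood
(`IsStrictNormalCrossingsAt.exists_isStrictNormalCrossingsDivisor_preimage`); closed points
suffice on the Jacobson scheme `X` (`IsNormalCrossingsDivisor.of_forall_closedPoints_exists_etale`).
[cite: DeJong1996, 2.4 and 4.25 (i), pp. 55, 75]; [cite: Kollar2007, Rem. 1.45] -/
theorem DeJong1996FormalNormalCrossings_holds : DeJong1996FormalNormalCrossings.{u} := by
  intro k _ _ X f Z d hN hreg
  haveI := hN.isIntegral
  haveI : LocallyOfFiniteType f := hN.locallyOfFiniteType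
  haveI : PerfectField k := IsAlgClosed.perfectField k
  haveI : JacobsonSpace X := LocallyOfFiniteType.jacobsonSpace f
  refine IsNormalCrossingsDivisor.of_forall_closedPoints_exists_etale hN.isClosed
    fun p hpZ hpcl => ?_
  -- the formal condition 4.25 (i) at the closed point `p ∈ Z`
  obtain ⟨r, hr1, hrd, e, he⟩ := hN.exists_ringEquiv_of_isRegularLocalRing p hpcl (hreg p) hpZ
  have hdim : ringKrullDim (X.presheaf.stalk p) = d := by
    rw [ringKrullDim_stalk_eq_of_isClosed f hpcl, hN.topologicalKrullDim_eq]
  obtain ⟨U, g, hg, u, hgu, hsnc⟩ :=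
    exists_etale_isStrictNormalCrossingsAt_of_formal_of_isAlgClosed f hN.isClosed (hreg p) hr1 hrd
      hdim e he
  haveI := hg
  -- spread to an open neighbourhood of `u`
  obtain ⟨V, huV, hV⟩ := hsnc.exists_isStrictNormalCrossingsDivisor_preimage (g ≫ f)
    (hN.isClosed.preimage g.continuous)
  refine ⟨V, V.ι ≫ g, inferInstance, ⟨⟨u, huV⟩, ?_⟩, ?_⟩
  · rw [← hgu]
    rfl
  · rwa [show ((V.ι ≫ g) ⁻¹' Z : Set V) = V.ι ⁻¹' (g ⁻¹' Z) by
      ext v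
      simp only [Set.mem_preimage, Scheme.Hom.comp_apply]]

end Literature.AlgebraicGeometry.Resolution

end
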